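import Summits.AnomalousDissipation.AnomalousDissipation.Theorems.SolenoidalFractalHomogenisationLagrangianStepOneLevelDefs
import Summits.AnomalousDissipation.AnomalousDissipation.Theorems.SolenoidalFractalHomogenisationLagrangianStepBaseT
import HarnessLib

/-!
# K1L `LagrangianRenormalisationStep` (stmt-AnomalousDissipation-24912), line `onelevel`: the PROVED GLUE of the skeleton of record, landed once

Helper file (strategist's Notes for provers §2 of `Cruxes/LagrangianRenormalisationStep/Lines/onelevel.md`): the sorry-free glue theorems of the
registered skeleton `Lines/onelevel.lean`, VERBATIM over the shared definitions (`…LagrangianStepDefs` p610007, `…LagrangianStepOneLevelDefs`):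

* `tensorCellPackage_of_clauses` / `clauses_of_tensorCellPackage` — the re-cut check: `WindowClause ∧ SlowVectorClause ∧ CellEnergyClauses` with one
  constant block is exactly v9's `TensorCellPackage`;
* `renormStep_window`, `shapeSeq_window` — the guarded `λ = 1` window is invariant under the named renormalisation recursion (convexity);
* `chainTensor_top`, `chainTensor_succ` — the named chain starts at `isoVisc (kbar j)` and steps by `renormStep`;
* `chain_of_pieces` — `Chain E` (v9's `stub_chainL` conclusion) from the one-level step (`stub_oneLevelL`'s statement as a hypothesis) and the base
  estimate (`stub_baseT`'s statement as a hypothesis);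
* `chain_of_oneLevel` — the same with the base estimate DISCHARGED by the landed `LagrangianStep.stub_baseT` (p612457): only the one-level step remains
  a hypothesis.

So the skeleton can import this file and keep only the registered stubs and the composition.  No definitions, no named facts, no sorry; rung-leaf
bookkeeping only.  Prover seat `ad-solenoidal-k2r-lowerlaw-p1` g5 (2026-08-28); glue authored by the crux-strategist cstrat-24912 in the skeleton.
-/

set_option linter.dupNamespace false

namespace Summit.AnomalousDissipation.AnomalousDissipation.Theorems.SolenoidalFractalHomogenisation.LagrangianStep

open Literature.Analysis Literature.Analysis.FluidPDE Literature.Analysis.FunctionSpaces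
open MeasureTheory Set Filter
open scoped ENNReal NNReal InnerProductSpace

noncomputable section

/-! ## The re-cut check -/

/-- **Re-cut check (proved).**  The window clause, the slow-vector clause and the cell-energy clauses with ONE common constant block are
exactly v9's `TensorCellPackage` — the re-cut of `stub_cellLawT` transcribes nothing wrongly. -/
theorem tensorCellPackage_of_clauses {k : ℕ} {W : LatticeShear.LatticeWord k} {M : ℝ} {hM : 0 < M} {c : ℝ}
    {Φ : Torus.Visc4 (Fin 3) → Torus.Visc4 (Fin 3)} {lo hi Λ β σ C ν₀ K : ℝ}
    (hlo : 0 < lo) (hlo1 : lo ≤ 1) (hhi1 : 1 ≤ hi) (hΛ : 1 < Λ) (hβ : 0 ≤ β) (hwin : WindowClause Φ lo hi Λ β)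
    (hσ : 0 < σ) (hC : 0 ≤ C) (hν₀ : 0 < ν₀) (hK : 0 < K)
    (hV : SlowVectorClause W M hM c Φ lo hi Λ β σ C ν₀ K) (hE : CellEnergyClauses W M hM c lo hi Λ β C ν₀ K) :
    TensorCellPackage W M hM c := by
  refine ⟨Φ, lo, hlo, hi, hlo1, hhi1, Λ, hΛ, β, hβ, hwin, σ, hσ, C, hC, ν₀, hν₀, K, hK, ?_⟩
  intro ν hν n 𝔸 hodd hwin'
  refine ⟨(hE ν hν n 𝔸 hodd hwin').1, ?_⟩
  intro ℓ hℓ hsep p hp hperp T hT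
  refine ⟨(hV ν hν n 𝔸 hodd hwin' ℓ hℓ hsep p hp hperp T hT).1, ?_⟩
  intro w v hw hv
  filter_upwards [(hV ν hν n 𝔸 hodd hwin' ℓ hℓ hsep p hp hperp T hT).2 w v hw hv,
    (hE ν hν n 𝔸 hodd hwin').2 ℓ hℓ hsep p hp hperp T hT w hw] with t h1 h2
  exact ⟨h1, h2⟩

/-- Conversely, v9's package yields the two clause blocks with a common constant block (so `stub_cellLawT` of v9 implies
`stub_cellLawV`, and the re-cut only ADDS the uniformity of `stub_cellEnergyT` in `M, c` and the window). -/
theorem clauses_of_tensorCellPackage {k : ℕ} {W : LatticeShear.LatticeWord k} {M : ℝ} {hM : 0 < M} {c : ℝ}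
    (h : TensorCellPackage W M hM c) :
    ∃ Φ : Torus.Visc4 (Fin 3) → Torus.Visc4 (Fin 3), ∃ lo > (0:ℝ), ∃ hi : ℝ, lo ≤ 1 ∧ 1 ≤ hi ∧ ∃ Λ > (1:ℝ), ∃ β ≥ (0:ℝ),
      WindowClause Φ lo hi Λ β ∧ ∃ σ > (0:ℝ), ∃ C : ℝ, 0 ≤ C ∧ ∃ ν₀ > (0:ℝ), ∃ K > (0:ℝ),
        SlowVectorClause W M hM c Φ lo hi Λ β σ C ν₀ K ∧ CellEnergyClauses W M hM c lo hi Λ β C ν₀ K := by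
  obtain ⟨Φ, lo, hlo, hi, hlo1, hhi1, Λ, hΛ, β, hβ, hwin, σ, hσ, C, hC, ν₀, hν₀, K, hK, hcell⟩ := h
  refine ⟨Φ, lo, hlo, hi, hlo1, hhi1, Λ, hΛ, β, hβ, hwin, σ, hσ, C, hC, ν₀, hν₀, K, hK, ?_, ?_⟩
  · intro ν hν n 𝔸 hodd hwin' ℓ hℓ hsep p hp hperp T hT
    obtain ⟨hex, hcmp⟩ := (hcell ν hν n 𝔸 hodd hwin').2 ℓ hℓ hsep p hp hperp T hT
    refine ⟨hex, fun w v hw hv => ?_⟩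
    filter_upwards [hcmp w v hw hv] with t ht
    exact ht.1
  · intro ν hν n 𝔸 hodd hwin'
    refine ⟨(hcell ν hν n 𝔸 hodd hwin').1, ?_⟩
    intro ℓ hℓ hsep p hp hperp T hT w hw
    obtain ⟨⟨v, hv⟩, hcmp⟩ := (hcell ν hν n 𝔸 hodd hwin').2 ℓ hℓ hsep p hp hperp T hT
    filter_upwards [hcmp w v hw hv] with t ht
    exact ht.2

/-! ## Proved glue (v10): window propagation by convexity, the named chain, `Chain E` from the one-level step -/

/-- Transport of a `NearIso` window along equal bounds. -/
theorem nearIso_congr {𝔸 : Torus.Visc4 (Fin 3)} {lo hi lo' hi' : ℝ} (h : Torus.NearIso 𝔸 lo hi) (e₁ : lo = lo') (e₂ : hi = hi') :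
    Torus.NearIso 𝔸 lo' hi' := e₁ ▸ e₂ ▸ h

/-- Transport of an `OddSmall` bound along an equal constant. -/
theorem oddSmall_congr {𝔸 : Torus.Visc4 (Fin 3)} {β β' : ℝ} (h : Torus.OddSmall 𝔸 β) (e : β = β') : Torus.OddSmall 𝔸 β' := e ▸ h

/-- One `renormStep` keeps the `λ = 1` window (convex combination of `S` and `Φ S`, both in the window). -/
theorem renormStep_window {Φ : Torus.Visc4 (Fin 3) → Torus.Visc4 (Fin 3)} {lo hi Λ β : ℝ}
    (hΛ : 1 ≤ Λ) (hβ : 0 ≤ β) (hwin : WindowClause Φ lo hi Λ β) {g : ℝ} (hg : 0 ≤ g)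
    {S : Torus.Visc4 (Fin 3)} (hSo : Torus.OddSmall S β) (hSn : Torus.NearIso S lo hi) :
    Torus.OddSmall (renormStep Φ g S) β ∧ Torus.NearIso (renormStep Φ g S) lo hi := by
  have h1 : (1:ℝ) ∈ Set.Icc (1:ℝ) Λ := ⟨le_rfl, hΛ⟩
  have hS' : Torus.NearIso S (lo / 1) (hi * 1) := by simpa using hSn
  obtain ⟨hΦo, hΦn⟩ := hwin 1 h1 S hSo hS'
  have hΦn' : Torus.NearIso (Φ S) lo hi := by simpa using hΦn
  have hg1 : (0:ℝ) ≤ 1 / (1 + g) := by positivity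
  have hne : (1 + g) ≠ 0 := by positivity
  refine ⟨?_, ?_⟩
  · have h := (hSo.add (hΦo.smul g) hβ (mul_nonneg hg hβ)).smul (1 / (1 + g))
    exact oddSmall_congr h (by field_simp)
  · have h := (hSn.add (hΦn'.smul hg)).smul hg1
    exact nearIso_congr h (by field_simp) (by field_simp)

/-- Every shape of the chain lies in the `λ = 1` window. -/
theorem shapeSeq_window {Φ : Torus.Visc4 (Fin 3) → Torus.Visc4 (Fin 3)} {lo hi Λ β : ℝ}
    (hlo1 : lo ≤ 1) (hhi1 : 1 ≤ hi) (hΛ : 1 ≤ Λ) (hβ : 0 ≤ β) (hwin : WindowClause Φ lo hi Λ β)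
    {g : ℕ → ℝ} (hg : ∀ i, 0 ≤ g i) (j : ℕ) :
    ∀ d, Torus.OddSmall (shapeSeq Φ g j d) β ∧ Torus.NearIso (shapeSeq Φ g j d) lo hi
  | 0 => ⟨Torus.oddSmall_isoVisc 1 β, (Torus.nearIso_isoVisc 1).mono hlo1 hhi1⟩
  | d + 1 => by
      obtain ⟨ho, hn⟩ := shapeSeq_window hlo1 hhi1 hΛ hβ hwin hg j d
      exact renormStep_window hΛ hβ hwin (hg (j - d)) ho hn

/-- The top tensor of the chain is the isotropic `kbar_j`. -/
theorem chainTensor_top {k : ℕ} (E : LatticeShear.LagrangianLatticeCarrier k) (Φ : Torus.Visc4 (Fin 3) → Torus.Visc4 (Fin 3)) (j : ℕ) :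
    chainTensor E Φ j j = Torus.isoVisc (E.kbar j) := by
  unfold chainTensor
  rw [Nat.sub_self, shapeSeq]
  funext i a j' b
  simp [Torus.isoVisc]

/-- Below the top, the level-`m` tensor is the renormalisation of the level-`(m+1)` shape. -/
theorem chainTensor_succ {k : ℕ} (E : LatticeShear.LagrangianLatticeCarrier k) (Φ : Torus.Visc4 (Fin 3) → Torus.Visc4 (Fin 3))
    {j m : ℕ} (h : m < j) :
    chainTensor E Φ j m = E.kbar m • renormStep Φ (E.gain / E.cellVisc (m + 1) ^ 2)
      (shapeSeq Φ (fun i => E.gain / E.cellVisc i ^ 2) j (j - (m + 1))) := by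
  unfold chainTensor
  have h1 : j - m = (j - (m + 1)) + 1 := by omega
  have h2 : j - (j - (m + 1)) = m + 1 := by omega
  rw [h1, shapeSeq, h2]

/-- **`Chain E` from the pieces (proved)**: the one-level step (with its existence conjunct) + the base estimate give the renormalised chain of
v9's `stub_chainL` for every carrier on the template (window by `shapeSeq_window`, top by `chainTensor_top`, consecutive levels by
`chainTensor_succ`, non-negativity of the drop by `stub_baseT`). -/
theorem chain_of_pieces
    (hba : ∀ k (E : LatticeShear.LagrangianLatticeCarrier k), E.LPermissible → E.Regular →
    ∀ (m : ℕ) (𝔸 : Torus.Visc4 (Fin 3)) (lo hi : ℝ), 0 < lo → Torus.NearIso 𝔸 lo hi →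
      ∀ (w₀ : VF) (u : ℝ → VF), IsDatum w₀ → TSol E m 𝔸 w₀ u →
        ∀ᵐ t ∂(volume.restrict (Ioo (1/2 : ℝ) 1)),
          (1 - Real.exp (-(4 * Real.pi ^ 2 * lo))) * Torus.vectorL2Sq w₀ ≤ drop w₀ u t)
    (hone : ∀ k (W : Literature.Analysis.FluidPDE.LatticeShear.LatticeWord k) (M : ℝ) (hM : 0 < M) (c : ℝ), 0 < c →
    ∀ (Φ : Torus.Visc4 (Fin 3) → Torus.Visc4 (Fin 3)) (lo hi Λ β σ C ν₀ K Cf νf Kf : ℝ),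
      0 < lo → lo ≤ 1 → 1 ≤ hi → 1 < Λ → 0 ≤ β → WindowClause Φ lo hi Λ β →
      0 < σ → 0 ≤ C → 0 < ν₀ → 0 < K → SlowVectorClause W M hM c Φ lo hi Λ β σ C ν₀ K →
      0 ≤ Cf → 0 < νf → 0 < Kf → CellEnergyClauses W M hM c lo hi Λ β Cf νf Kf →
      ∃ ν₁ > (0:ℝ), ∃ K₁ > (0:ℝ), ∃ Λ₀ : ℕ, ∃ θ₀ > (0:ℝ), ∃ C₁ > (0:ℝ), ∃ σ₁ > (0:ℝ),
        ∀ E : Literature.Analysis.FluidPDE.LatticeShear.LagrangianLatticeCarrier k, E.design = W.stretch M hM → E.gain = c → E.nu0 = ν₁ → E.K = K₁ → E.LPermissible → E.Regular → (∀ m, Λ₀ * E.N m ≤ E.N (m + 1)) → (∀ m, E.N m ^ 2 ≤ E.N (m + 1)) → (∀ m, E.cellVisc (m + 1) * ((E.N (m + 1) : ℝ) / E.N m) ^ (1 / 4 : ℝ) ≤ 1) → (∀ m, E.K * ((E.N (m + 1) : ℝ) / E.N m) ^ (1 / 4 : ℝ) ≤ ((E.N (m + 1) : ℝ) / E.N m)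 * E.cellVisc (m + 1)) → (∀ m, E.θ (m + 1) * ((E.N (m + 1) : ℝ) / E.N m) ^ (1 / 16 : ℝ) ≤ θ₀) → (∀ m, ((E.N (m + 1) : ℝ) / E.N m) ^ (1 / 16 : ℝ) * E.physPeriod (m + 1) ≤ E.refresh (m + 1)) →
        ∀ R : ℝ≥0, ∃ mstar : ℕ, ∀ m, mstar ≤ m →
          ∀ S : Torus.Visc4 (Fin 3), Torus.OddSmall S β → Torus.NearIso S lo hi →
          ∀ (w₀ : VF), IsDatum w₀ → InClass R w₀ →
          (∃ v, TSol E m (E.kbar m • renormStep Φ (E.gain / E.cellVisc (m + 1) ^ 2) S) w₀ v) ∧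
          ∀ u v : ℝ → VF, TSol E (m + 1) (E.kbar (m + 1) • S) w₀ u →
            TSol E m (E.kbar m • renormStep Φ (E.gain / E.cellVisc (m + 1) ^ 2) S) w₀ v →
            ∀ᵐ t ∂(volume.restrict (Ioo (1/2 : ℝ) 1)),
              (1 - C₁ * ((E.N m : ℝ) / E.N (m + 1)) ^ σ₁) * drop w₀ v t ≤ drop w₀ u t ∧
              drop w₀ u t ≤ (1 + C₁ * ((E.N m : ℝ) / E.N (m + 1)) ^ σ₁) * drop w₀ v t) :
    ∀ k (W : Literature.Analysis.FluidPDE.LatticeShear.LatticeWord k) (M : ℝ) (hM : 0 < M) (c : ℝ), 0 < c →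
    ∀ (Φ : Torus.Visc4 (Fin 3) → Torus.Visc4 (Fin 3)) (lo hi Λ β σ C ν₀ K Cf νf Kf : ℝ),
      0 < lo → lo ≤ 1 → 1 ≤ hi → 1 < Λ → 0 ≤ β → WindowClause Φ lo hi Λ β →
      0 < σ → 0 ≤ C → 0 < ν₀ → 0 < K → SlowVectorClause W M hM c Φ lo hi Λ β σ C ν₀ K →
      0 ≤ Cf → 0 < νf → 0 < Kf → CellEnergyClauses W M hM c lo hi Λ β Cf νf Kf →
      ∃ ν₁ > (0:ℝ), ∃ K₁ > (0:ℝ), ∃ Λ₀ : ℕ, ∃ θ₀ > (0:ℝ),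
        ∀ E : Literature.Analysis.FluidPDE.LatticeShear.LagrangianLatticeCarrier k, E.design = W.stretch M hM → E.gain = c → E.nu0 = ν₁ → E.K = K₁ → E.LPermissible → E.Regular → (∀ m, Λ₀ * E.N m ≤ E.N (m + 1)) → (∀ m, E.N m ^ 2 ≤ E.N (m + 1)) → (∀ m, E.cellVisc (m + 1) * ((E.N (m + 1) : ℝ) / E.N m) ^ (1 / 4 : ℝ) ≤ 1) → (∀ m, E.K * ((E.N (m + 1) : ℝ) / E.N m) ^ (1 / 4 : ℝ) ≤ ((E.N (m + 1) : ℝ) / E.N m) * E.cellVisc (m + 1)) → (∀ m, E.θ (m + 1) * ((E.N (m + 1) : ℝ) / E.N m) ^ (1 / 16 : ℝ) ≤ θ₀) → (∀ m, ((E.N (m + 1) : ℝ) / E.N m) ^ (1 / 16 : ℝ) * E.physPeriod (m + 1) ≤ E.refresh (m + 1)) → Chain E := by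
  intro k W M hM c hc Φ lo hi Λ β σ C ν₀ K Cf νf Kf hlo hlo1 hhi1 hΛ hβ hwin hσ hC hν₀ hK hV hCf hνf hKf hEcl
  obtain ⟨ν₁, hν₁, K₁, hK₁, Λ₀, θ₀, hθ₀, C₁, hC₁, σ₁, hσ₁, hlev⟩ :=
    hone k W M hM c hc Φ lo hi Λ β σ C ν₀ K Cf νf Kf hlo hlo1 hhi1 hΛ hβ hwin hσ hC hν₀ hK hV hCf hνf hKf hEcl
  refine ⟨ν₁, hν₁, K₁, hK₁, Λ₀, θ₀, hθ₀, ?_⟩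
  intro E hW hg hn hK' hP hR h1a h1b h2 h3 h4 h5
  have hlevE := hlev E hW hg hn hK' hP hR h1a h1b h2 h3 h4 h5
  have hgpos : ∀ i, 0 ≤ E.gain / E.cellVisc i ^ 2 := fun i => div_nonneg E.gain_pos.le (sq_nonneg _)
  have hwinS : ∀ j d, Torus.OddSmall (shapeSeq Φ (fun i => E.gain / E.cellVisc i ^ 2) j d) β ∧
      Torus.NearIso (shapeSeq Φ (fun i => E.gain / E.cellVisc i ^ 2) j d) lo hi :=
    fun j d => shapeSeq_window hlo1 hhi1 hΛ.le hβ hwin hgpos j d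
  have hwinT : ∀ j m, Torus.NearIso (chainTensor E Φ j m) (E.kbar m * lo) (E.kbar m * hi) :=
    fun j m => ((hwinS j (j - m)).2).smul (E.kbar_pos m).le
  refine ⟨lo, hlo, hi, C₁, hC₁, σ₁, hσ₁, ?_⟩
  intro R
  obtain ⟨mstar, hm⟩ := hlevE R
  refine ⟨mstar, fun j hj => ⟨chainTensor E Φ j, chainTensor_top E Φ j, fun m _ _ => hwinT j m, ?_⟩⟩
  intro m hm1 hm2 w₀ hdat hcl
  have hstep := hm m hm1 (shapeSeq Φ (fun i => E.gain / E.cellVisc i ^ 2) j (j - (m + 1)))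
    (hwinS j (j - (m + 1))).1 (hwinS j (j - (m + 1))).2 w₀ hdat hcl
  refine ⟨?_, ?_⟩
  · rw [chainTensor_succ E Φ hm2]
    exact hstep.1
  intro u v hu hv
  have hv' := hv
  rw [chainTensor_succ E Φ hm2] at hv'
  have hu' : TSol E (m + 1) (E.kbar (m + 1) • shapeSeq Φ (fun i => E.gain / E.cellVisc i ^ 2) j (j - (m + 1))) w₀ u := hu
  have hcmp := hstep.2 u v hu' hv'
  have hbase := hba k E hP hR m (chainTensor E Φ j m) (E.kbar m * lo) (E.kbar m * hi)
    (mul_pos (E.kbar_pos m) hlo) (hwinT j m) w₀ v hdat hv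
  have hcb : 0 ≤ 1 - Real.exp (-(4 * Real.pi ^ 2 * (E.kbar m * lo))) := by
    have hexp : Real.exp (-(4 * Real.pi ^ 2 * (E.kbar m * lo))) < 1 := by
      rw [Real.exp_lt_one_iff]
      have : 0 < 4 * Real.pi ^ 2 * (E.kbar m * lo) := by
        have := E.kbar_pos m
        positivity
      linarith
    linarith
  have hL2 : 0 ≤ Torus.vectorL2Sq w₀ := by
    show 0 ≤ ∫ x, ‖w₀ x‖ ^ 2
    exact integral_nonneg fun x => by positivity
  filter_upwards [hcmp, hbase] with t h1 h2
  exact ⟨le_trans (mul_nonneg hcb hL2) h2, h1.1, h1.2⟩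

/-- **`Chain E` from the one-level step alone**: `chain_of_pieces` with the base estimate discharged by the landed registered stub
`LagrangianStep.stub_baseT` (p612457). -/
theorem chain_of_oneLevel
    (hone : ∀ k (W : Literature.Analysis.FluidPDE.LatticeShear.LatticeWord k) (M : ℝ) (hM : 0 < M) (c : ℝ), 0 < c →
    ∀ (Φ : Torus.Visc4 (Fin 3) → Torus.Visc4 (Fin 3)) (lo hi Λ β σ C ν₀ K Cf νf Kf : ℝ),
      0 < lo → lo ≤ 1 → 1 ≤ hi → 1 < Λ → 0 ≤ β → WindowClause Φ lo hi Λ β →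
      0 < σ → 0 ≤ C → 0 < ν₀ → 0 < K → SlowVectorClause W M hM c Φ lo hi Λ β σ C ν₀ K →
      0 ≤ Cf → 0 < νf → 0 < Kf → CellEnergyClauses W M hM c lo hi Λ β Cf νf Kf →
      ∃ ν₁ > (0:ℝ), ∃ K₁ > (0:ℝ), ∃ Λ₀ : ℕ, ∃ θ₀ > (0:ℝ), ∃ C₁ > (0:ℝ), ∃ σ₁ > (0:ℝ),
        ∀ E : Literature.Analysis.FluidPDE.LatticeShear.LagrangianLatticeCarrier k, E.design = W.stretch M hM → E.gain = c → E.nu0 = ν₁ → E.K = K₁ → E.LPermissible → E.Regular → (∀ m, Λ₀ * E.N m ≤ E.N (m + 1)) → (∀ m, E.N m ^ 2 ≤ E.N (m + 1)) → (∀ m, E.cellVisc (m + 1) * ((E.N (m + 1) : ℝ) / E.N m) ^ (1 / 4 : ℝ) ≤ 1) → (∀ m, E.K * ((E.N (m + 1) : ℝ) / E.N m) ^ (1 / 4 : ℝ) ≤ ((E.N (m + 1) : ℝ) / E.N m) * E.cellVisc (m + 1)) → (∀ m, E.θ (m + 1) * ((E.N (m + 1) : ℝ) / E.N m) ^ (1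 / 16 : ℝ) ≤ θ₀) → (∀ m, ((E.N (m + 1) : ℝ) / E.N m) ^ (1 / 16 : ℝ) * E.physPeriod (m + 1) ≤ E.refresh (m + 1)) →
        ∀ R : ℝ≥0, ∃ mstar : ℕ, ∀ m, mstar ≤ m →
          ∀ S : Torus.Visc4 (Fin 3), Torus.OddSmall S β → Torus.NearIso S lo hi →
          ∀ (w₀ : VF), IsDatum w₀ → InClass R w₀ →
          (∃ v, TSol E m (E.kbar m • renormStep Φ (E.gain / E.cellVisc (m + 1) ^ 2) S) w₀ v) ∧
          ∀ u v : ℝ → VF, TSol E (m + 1) (E.kbar (m + 1) • S) w₀ u →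
            TSol E m (E.kbar m • renormStep Φ (E.gain / E.cellVisc (m + 1) ^ 2) S) w₀ v →
            ∀ᵐ t ∂(volume.restrict (Ioo (1/2 : ℝ) 1)),
              (1 - C₁ * ((E.N m : ℝ) / E.N (m + 1)) ^ σ₁) * drop w₀ v t ≤ drop w₀ u t ∧
              drop w₀ u t ≤ (1 + C₁ * ((E.N m : ℝ) / E.N (m + 1)) ^ σ₁) * drop w₀ v t) :
    ∀ k (W : Literature.Analysis.FluidPDE.LatticeShear.LatticeWord k) (M : ℝ) (hM : 0 < M) (c : ℝ), 0 < c →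
    ∀ (Φ : Torus.Visc4 (Fin 3) → Torus.Visc4 (Fin 3)) (lo hi Λ β σ C ν₀ K Cf νf Kf : ℝ),
      0 < lo → lo ≤ 1 → 1 ≤ hi → 1 < Λ → 0 ≤ β → WindowClause Φ lo hi Λ β →
      0 < σ → 0 ≤ C → 0 < ν₀ → 0 < K → SlowVectorClause W M hM c Φ lo hi Λ β σ C ν₀ K →
      0 ≤ Cf → 0 < νf → 0 < Kf → CellEnergyClauses W M hM c lo hi Λ β Cf νf Kf →
      ∃ ν₁ > (0:ℝ), ∃ K₁ > (0:ℝ), ∃ Λ₀ : ℕ, ∃ θ₀ > (0:ℝ),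
        ∀ E : Literature.Analysis.FluidPDE.LatticeShear.LagrangianLatticeCarrier k, E.design = W.stretch M hM → E.gain = c → E.nu0 = ν₁ → E.K = K₁ → E.LPermissible → E.Regular → (∀ m, Λ₀ * E.N m ≤ E.N (m + 1)) → (∀ m, E.N m ^ 2 ≤ E.N (m + 1)) → (∀ m, E.cellVisc (m + 1) * ((E.N (m + 1) : ℝ) / E.N m) ^ (1 / 4 : ℝ) ≤ 1) → (∀ m, E.K * ((E.N (m + 1) : ℝ) / E.N m) ^ (1 / 4 : ℝ) ≤ ((E.N (m + 1) : ℝ) / E.N m) * E.cellVisc (m + 1)) → (∀ m, E.θ (m + 1) * ((E.N (m + 1) : ℝ) / E.N m) ^ (1 / 16 : ℝ) ≤ θ₀) → (∀ m, ((E.N (m + 1) : ℝ) / E.N m) ^ (1 / 16 : ℝ) * E.physPeriod (m + 1) ≤ E.refresh (m + 1)) → Chain E :=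
  chain_of_pieces stub_baseT hone

end

end Summit.AnomalousDissipation.AnomalousDissipation.Theorems.SolenoidalFractalHomogenisation.LagrangianStep
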